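import Summits.BirchSwinnertonDyer.BirchSwinnertonDyer.Theorems.ManinLocalTwoThreeCDivisionNeronPeriods
import HarnessLib

/-!
# THE `c`-DIVISION WITNESS ∧ CDT — PART 2 (§4–§5 of -an g45's `CDivisionNeronPeriods-an-g45.lean` v3 sha16 3b8e276f040d6fd5, VERBATIM;
# landing copy prover p3 gen 18 for T-an-g45): consequences of `Λ₁(f) ⊆ Λ_W` for a lattice-optimal `X₀(N)`-datum and the route compositions
# BY NAME (C3, the residual C4, C2 with E-an-152b/152d/152e, `ManinConstantOne` through the route's `closes`).
See PART 1 `…CDivisionNeronPeriods.lean` for the full module commentary.  HONEST FRAMING: CONDITIONAL architecture (printed CDT fact as a hypothesis;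
open rows E-an-152b/152c/152d/152e for C2); no Manin-constant statement, no Stevens conjecture and nothing about BSD is proved unconditionally here.
No sorry; the only `def`s are `Prop`-valued statement rows. [cite: CalegariDimitrovTang2025, Thm. 1.0.1 and Remarks 58–59] [cite: LingOesterle1991, Thm. 6]
[cite: Stevens1989, §2] [cite: Manin1972, Prop. 1.4, Thm. 1.6] [cite: AtkinLehner1970, Thm. 3]
-/

set_option autoImplicit false
-- lint-debt: the directory name repeats the summit name (sibling precedent `ManinLocalTwoThreeDivisionCoverUDC.lean`)
set_option linter.dupNamespace false

noncomputable section

open scoped MatrixGroups ModularForm Manifold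
open CongruenceSubgroup Complex ModularGroup
open WeierstrassCurve Literature.NumberTheory.EllipticCurves Literature.NumberTheory.EllipticCurves.ModularForms
open Literature.NumberTheory.Automorphic
open Summit.BirchSwinnertonDyer.Rank1Residual.ManinAdditive.UDCKummerLineK
open Summit.BirchSwinnertonDyer.Rank1Residual.ManinAdditive.ShimuraKernel

namespace Summit.BirchSwinnertonDyer.BirchSwinnertonDyer.Theorems.ManinLocalTwoThree.CDivisionNeron

variable {W : WeierstrassCurve ℚ} [W.IsElliptic] [W.IsGloballyMinimal] {N : ℕ} [NeZero N]

/-! ## §4 Consequences of `Λ₁(f) ⊆ Λ_W` for a lattice-optimal `X₀(N)`-datum (all unconditional implications) -/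

omit [W.IsElliptic] [W.IsGloballyMinimal] in
/-- From the generators to the lattice: `(∀ γ ∈ Γ₁(N), {∞,γ∞}_f ∈ Λ_W) ⟹ Λ₁(f) ⊆ Λ_W`. [cite: Manin1972, Prop. 1.4] -/
theorem periodLatticeGamma1_le_lattice_of_forall_gamma1 (D : ModularParametrizationData W N)
    (h : ∀ γ : Gamma1 N, cuspSymbol D.f ⟨(γ : SL(2, ℤ)), Gamma1_in_Gamma0 N γ.2⟩ ∈ D.L.lattice) :
    ∀ z ∈ periodLatticeGamma1 D.f, z ∈ D.L.lattice := by
  intro z hz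
  induction hz using AddSubgroup.closure_induction with
  | mem x hx =>
    obtain ⟨γ, rfl⟩ := hx
    exact h γ
  | zero => exact zero_mem _
  | add x y _ _ hx hy => exact add_mem hx hy
  | neg x _ hx => exact neg_mem hx

omit [NeZero N] in
/-- **`(n/c)·ω₁ ∈ Λ_W` forces `c ∣ n`.** [folklore] -/
theorem dvd_of_div_mul_ω₁_mem (L : PeriodPair) {c : ℤ} (hc : c ≠ 0) {n : ℕ}
    (h : ((n : ℂ) / (c : ℂ)) * L.ω₁ ∈ L.lattice) : c ∣ (n : ℤ) := by
  have e : ((n : ℂ) / (c : ℂ)) * L.ω₁ = ((((n : ℤ) : ℚ) / (c : ℚ) : ℚ) : ℂ) * L.ω₁ + ((0 : ℚ) : ℂ) * L.ω₂ := by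
    push_cast; ring
  rw [e] at h
  have hden := (PeriodPair.mul_ω₁_add_mul_ω₂_mem_lattice (L := L) (α := ((n : ℤ) : ℚ) / (c : ℚ)) (β := 0)).mp h
  exact (Rat.den_div_intCast_eq_one_iff (n : ℤ) c hc).mp hden.1

omit [W.IsElliptic] [W.IsGloballyMinimal] in
/-- **`Λ₁(f) ⊆ Λ_W = c₀Λ₀(f)` and `nΛ₀(f) ⊆ Λ₁(f)` force `c₀ ∣ n`** (lattice-optimal datum): `ω₁ = c·w₁`, `n·w₁ ∈ Λ₁ ⊆ Λ_W`, so `(n/c)·ω₁ ∈ Λ_W`.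
[cite: Manin1972, Thm. 1.6] [cite: LingOesterle1991, Thm. 6] -/
theorem maninConstant_dvd_of_gamma1Periods_le (D : ModularParametrizationData W N)
    (hopt : ∀ z ∈ D.L.lattice, ∃ w ∈ periodLattice D.f, z = D.c * w)
    (hSI : ∀ z ∈ periodLatticeGamma1 D.f, z ∈ D.L.lattice) {n : ℕ}
    (hn : ∀ z ∈ periodLattice D.f, (n : ℂ) * z ∈ periodLatticeGamma1 D.f) : D.maninConstant ∣ (n : ℤ) := by
  obtain ⟨w₁, hw₁, e₁⟩ := hopt D.L.ω₁ D.L.ω₁_mem_lattice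
  have hmem : (n : ℂ) * w₁ ∈ D.L.lattice := hSI _ (hn w₁ hw₁)
  have hc : (D.c : ℂ) ≠ 0 := D.cast_c_ne_zero
  have e : (n : ℂ) * w₁ = ((n : ℂ) / (D.c : ℂ)) * D.L.ω₁ := by
    rw [e₁, div_mul_eq_mul_div, eq_div_iff hc]; ring
  rw [e] at hmem
  exact dvd_of_div_mul_ω₁_mem D.L (c_ne_zero D) hmem

omit [W.IsElliptic] [W.IsGloballyMinimal] in
/-- **At a traceless prime `p` (`p² ∣ N`): `Λ₁(f) ⊆ Λ_W` forces `c₀ ∣ p`** (`a_p = 0` by Atkin–Lehner, `pΛ₀(f) ⊆ Λ₁(f)` by Ling–Oesterlé, tree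
`pMulLatticeLeGamma1OfTracelessPrime_holds`). [cite: AtkinLehner1970, Thm. 3] [cite: LingOesterle1991, Thm. 6] -/
theorem maninConstant_dvd_prime_of_gamma1Periods_le_of_sq_dvd (D : ModularParametrizationData W N)
    (hopt : ∀ z ∈ D.L.lattice, ∃ w ∈ periodLattice D.f, z = D.c * w)
    (hSI : ∀ z ∈ periodLatticeGamma1 D.f, z ∈ D.L.lattice) {p : ℕ} (hp : p.Prime) (hpN : p ^ 2 ∣ N) :
    D.maninConstant ∣ (p : ℤ) :=
  maninConstant_dvd_of_gamma1Periods_le D hopt hSI fun z hz ↦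
    pMulLatticeLeGamma1OfTracelessPrime_holds N D.f D.isNewformOf.1 p hp ((dvd_pow_self p two_ne_zero).trans hpN)
      (D.isNewformOf.1.cuspCoeff_eq_zero_of_sq_dvd hp hpN) z hz

omit [W.IsElliptic] [W.IsGloballyMinimal] in
/-- **`|c₀| = 1` at every level divisible by the square of an ODD prime, given `Λ₁(f) ⊆ Λ_W`** (lattice-optimal datum): `c₀ ∣ p`, and `|c₀| = p` would
make `Λ_W = ±pΛ₀(f)`, `pΛ₀ ⊆ Λ₁ ⊆ Λ_W = pΛ₀`, the index-`p²` configuration — excluded unconditionally for `p ≥ 3`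
(`not_periodLatticeGamma1_eq_natCast_mul_periodLattice`).  Unconditional implication; Manin's conjecture is not proved by this.
[cite: AtkinLehner1970, Thm. 3] [cite: LingOesterle1991, Thm. 6] [cite: Stevens1989, §2] -/
theorem abs_maninConstant_eq_one_of_gamma1Periods_le_of_odd_sq_dvd (D : ModularParametrizationData W N)
    (hopt : ∀ z ∈ D.L.lattice, ∃ w ∈ periodLattice D.f, z = D.c * w)
    (hSI : ∀ z ∈ periodLatticeGamma1 D.f, z ∈ D.L.lattice) {p : ℕ} (hp : p.Prime) (h3 : 3 ≤ p) (hpN : p ^ 2 ∣ N) :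
    |D.maninConstant| = 1 := by
  have hdvd : D.c ∣ (p : ℤ) := maninConstant_dvd_prime_of_gamma1Periods_le_of_sq_dvd D hopt hSI hp hpN
  have hnat : D.c.natAbs ∣ p := Int.dvd_natCast.mp hdvd
  rcases (Nat.dvd_prime hp).mp hnat with h1 | hcp
  · show |D.c| = 1
    rw [Int.abs_eq_natAbs, h1, Nat.cast_one]
  · exfalso
    have hsm : ∀ z ∈ periodLattice D.f, (p : ℂ) * z ∈ periodLatticeGamma1 D.f := fun z hz ↦
      pMulLatticeLeGamma1OfTracelessPrime_holds N D.f D.isNewformOf.1 p hp ((dvd_pow_self p two_ne_zero).trans hpN)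
        (D.isNewformOf.1.cuspCoeff_eq_zero_of_sq_dvd hp hpN) z hz
    have hcases : D.c = (p : ℤ) ∨ D.c = -(p : ℤ) := by
      rcases Int.natAbs_eq D.c with h | h
      · left; rw [h, hcp]
      · right; rw [h, hcp]
    refine not_periodLatticeGamma1_eq_natCast_mul_periodLattice D hopt h3 fun z ↦ ⟨fun hz ↦ ?_, ?_⟩
    · obtain ⟨w, hw, e⟩ := hopt z (hSI z hz)
      rcases hcases with h | h
      · exact ⟨w, hw, by rw [e, h]; push_cast; ring⟩
      · exact ⟨-w, neg_mem hw, by rw [e, h]; push_cast; ring⟩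
    · rintro ⟨w, hw, rfl⟩
      exact hsm w hw

omit [W.IsElliptic] [W.IsGloballyMinimal] in
/-- **At `4 ∣ N`: `Λ₁(f) ⊆ Λ_W` forces `c₀ ∣ 2`** (`2Λ₀(f) ⊆ Λ₁(f)`, `two_mul_mem_periodLatticeGamma1_of_four_dvd`), i.e. `c₀ ∈ {±1, ±2}`.
[cite: LingOesterle1991, Thm. 6] [cite: Manin1972, Thm. 1.6] -/
theorem maninConstant_dvd_two_of_gamma1Periods_le_of_four_dvd (D : ModularParametrizationData W N)
    (hopt : ∀ z ∈ D.L.lattice, ∃ w ∈ periodLattice D.f, z = D.c * w)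
    (hSI : ∀ z ∈ periodLatticeGamma1 D.f, z ∈ D.L.lattice) (h4 : 2 ^ 2 ∣ N) : D.maninConstant ∣ 2 := by
  have h := maninConstant_dvd_of_gamma1Periods_le D hopt hSI (n := 2) fun z hz ↦ by
    exact_mod_cast two_mul_mem_periodLatticeGamma1_of_four_dvd D h4 hz
  exact_mod_cast h

omit [W.IsElliptic] [W.IsGloballyMinimal] in
/-- **At `4 ∣ N`: `Λ₁(f) ⊆ Λ_W` and `2 ∣ c₀` force the index-`4` configuration `Λ₁(f) = 2Λ₀(f)`** (`c₀ = ±2`, `Λ_W = 2Λ₀`, `2Λ₀ ⊆ Λ₁ ⊆ Λ_W`).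
[cite: LingOesterle1991, Thm. 6] [cite: Stevens1989, §2] -/
theorem indexFour_of_gamma1Periods_le_of_four_dvd_of_two_dvd (D : ModularParametrizationData W N)
    (hopt : ∀ z ∈ D.L.lattice, ∃ w ∈ periodLattice D.f, z = D.c * w)
    (hSI : ∀ z ∈ periodLatticeGamma1 D.f, z ∈ D.L.lattice) (h4 : 2 ^ 2 ∣ N) (h2 : (2 : ℤ) ∣ D.maninConstant) :
    ∀ z : ℂ, z ∈ periodLatticeGamma1 D.f ↔ ∃ w ∈ periodLattice D.f, z = 2 * w := by
  have hdvd : D.c ∣ 2 := maninConstant_dvd_two_of_gamma1Periods_le_of_four_dvd D hopt hSI h4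
  have habs : D.c.natAbs = 2 := by
    apply Nat.dvd_antisymm
    · exact Int.dvd_natCast.mp (by exact_mod_cast hdvd)
    · exact Int.natCast_dvd.mp (by exact_mod_cast h2)
  have hcases : D.c = 2 ∨ D.c = -2 := by
    rcases Int.natAbs_eq D.c with h | h
    · left; rw [h, habs]; rfl
    · right; rw [h, habs]; rfl
  intro z
  refine ⟨fun hz ↦ ?_, ?_⟩
  · obtain ⟨w, hw, e⟩ := hopt z (hSI z hz)
    rcases hcases with h | h
    · exact ⟨w, hw, by rw [e, h]; push_cast; ring⟩
    · exact ⟨-w, neg_mem hw, by rw [e, h]; push_cast; ring⟩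
  · rintro ⟨w, hw, rfl⟩
    exact two_mul_mem_periodLatticeGamma1_of_four_dvd D h4 hw

omit [W.IsElliptic] [W.IsGloballyMinimal] in
/-- **At `4 ∣ N`: `Λ₁(f) ⊆ Λ_W` and `Λ₁(f) ≠ 2Λ₀(f)` (E-an-152b for this datum) give `2 ∤ c₀`.** [cite: LingOesterle1991, Thm. 6] [cite: Stevens1989, §2] -/
theorem not_two_dvd_maninConstant_of_gamma1Periods_le_of_indexNeFour (D : ModularParametrizationData W N)
    (hopt : ∀ z ∈ D.L.lattice, ∃ w ∈ periodLattice D.f, z = D.c * w)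
    (hSI : ∀ z ∈ periodLatticeGamma1 D.f, z ∈ D.L.lattice) (h4 : 2 ^ 2 ∣ N)
    (hI4 : ¬ ∀ z : ℂ, z ∈ periodLatticeGamma1 D.f ↔ ∃ w ∈ periodLattice D.f, z = 2 * w) :
    ¬ (2 : ℤ) ∣ D.maninConstant :=
  fun h2 ↦ hI4 (indexFour_of_gamma1Periods_le_of_four_dvd_of_two_dvd D hopt hSI h4 h2)

/-! ## §5 The route compositions BY NAME: C3, the residual C4, C2 (with E-an-152b), and `ManinConstantOne` through the route's `closes` -/

/-- **`|c₀| = 1` at every level with an odd square factor ⟸ CDT ∧ E-an-242** (lattice-optimal `X₀(N)`-datum of a globally minimal curve).  CONDITIONAL on the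
printed CDT fact and the OPEN analytic row; Manin's conjecture is not proved by this. [cite: CalegariDimitrovTang2025, Thm. 1.0.1] [cite: LingOesterle1991, Thm. 6] -/
theorem abs_maninConstant_eq_one_of_CDT_cDivisionWitnessLaw_of_odd_sq_dvd
    (hCDT : Literature.NumberTheory.Automorphic.CalegariDimitrovTang2025_unboundedDenominators_algInt) (hCW : CDivisionWitnessLaw)
    (D : ModularParametrizationData W N) (hopt : ∀ z ∈ D.L.lattice, ∃ w ∈ periodLattice D.f, z = D.c * w)
    {p : ℕ} (hp : p.Prime) (h3 : 3 ≤ p) (hpN : p ^ 2 ∣ N) : |D.maninConstant| = 1 :=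
  abs_maninConstant_eq_one_of_gamma1Periods_le_of_odd_sq_dvd D hopt
    (periodLatticeGamma1_le_lattice_of_forall_gamma1 D (gamma1PeriodsInNeronLattice_of_CDT_of_cDivisionWitnessLaw hCDT hCW W D)) hp h3 hpN

/-- `|c| = 1` excludes every prime divisor. [folklore] -/
theorem not_prime_dvd_of_abs_eq_one {c : ℤ} (h : |c| = 1) {p : ℕ} (hp : p.Prime) : ¬ (p : ℤ) ∣ c := by
  intro hpc
  have h1 : c.natAbs = 1 := by
    have : (c.natAbs : ℤ) = 1 := by rw [Int.natCast_natAbs]; exact h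
    exact_mod_cast this
  have : p ∣ 1 := h1 ▸ Int.natCast_dvd.mp hpc
  exact hp.one_lt.ne' (Nat.dvd_one.mp this)

/-- **C3 `ManinPrimeToThreeAtNine` ⟸ CDT ∧ E-an-242** (the crux's four printed-fact binders unused).  CONDITIONAL; C3 is not proved by this.
[cite: CalegariDimitrovTang2025, Thm. 1.0.1] [cite: LingOesterle1991, Thm. 6] -/
theorem maninPrimeToThreeAtNine_of_CDT_cDivisionWitnessLaw
    (hCDT : Literature.NumberTheory.Automorphic.CalegariDimitrovTang2025_unboundedDenominators_algInt) (hCW : CDivisionWitnessLaw) :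
    Summit.BirchSwinnertonDyer.BirchSwinnertonDyer.Theses.ManinLocalTwoThree.ManinPrimeToThreeAtNine := by
  intro _hM _hAU _hC _hnf W _ _ N _ D hopt h9
  exact not_prime_dvd_of_abs_eq_one
    (abs_maninConstant_eq_one_of_CDT_cDivisionWitnessLaw_of_odd_sq_dvd hCDT hCW D hopt Nat.prime_three le_rfl h9) Nat.prime_three

/-- **THE RESIDUAL CONJUNCT C4 `ManinPrimeToAdditiveFiveLe` ⟸ CDT ∧ E-an-242** — `p ∤ c₀` for every prime `p ≥ 5` with `p² ∣ N` (declared residual of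
the route, «open at `p = 5, 7` and at potentially ordinary Kodaira types II/III/IV»): the SAME analytic row as C2/C3, no Raynaud constraint `e < p − 1`.
CONDITIONAL on the printed CDT fact and the OPEN analytic row; C4 is not proved by this. [cite: CalegariDimitrovTang2025, Thm. 1.0.1] [cite: LingOesterle1991, Thm. 6]
[cite: EdixhovenManin1991, Thm. 3] -/
theorem maninPrimeToAdditiveFiveLe_of_CDT_cDivisionWitnessLaw
    (hCDT : Literature.NumberTheory.Automorphic.CalegariDimitrovTang2025_unboundedDenominators_algInt) (hCW : CDivisionWitnessLaw) :
    Summit.BirchSwinnertonDyer.BirchSwinnertonDyer.Theses.ManinLocalTwoThree.ManinPrimeToAdditiveFiveLe := by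
  intro _hM _hAU _hC _hnf W _ _ N _ D hopt p hp h5 hpN
  exact not_prime_dvd_of_abs_eq_one
    (abs_maninConstant_eq_one_of_CDT_cDivisionWitnessLaw_of_odd_sq_dvd hCDT hCW D hopt hp (by omega) hpN) hp

/-- **C2 `ManinOddAtFour` ⟸ CDT ∧ E-an-242 ∧ E-an-152b `ShimuraIndexNeFourAtFour`.**  CONDITIONAL on the three inputs; C2 is not proved by this.
[cite: CalegariDimitrovTang2025, Thm. 1.0.1] [cite: LingOesterle1991, Thm. 6] [cite: Stevens1989, §2] -/
theorem maninOddAtFour_of_CDT_cDivisionWitnessLaw_indexNeFour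
    (hCDT : Literature.NumberTheory.Automorphic.CalegariDimitrovTang2025_unboundedDenominators_algInt) (hCW : CDivisionWitnessLaw)
    (hI4 : ShimuraIndexNeFourAtFour) :
    Summit.BirchSwinnertonDyer.BirchSwinnertonDyer.Theses.ManinLocalTwoThree.ManinOddAtFour := by
  intro _hM _hAU _hC _hnf W _ _ N _ D hopt h4
  exact not_two_dvd_maninConstant_of_gamma1Periods_le_of_indexNeFour D hopt
    (periodLatticeGamma1_le_lattice_of_forall_gamma1 D (gamma1PeriodsInNeronLattice_of_CDT_of_cDivisionWitnessLaw hCDT hCW W D)) h4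
    (hI4 W D hopt h4)

/-- **Row E-an-152c `ShimuraIndexNeFourAtFourOddSquarefree` — THE SHARPENED RESIDUAL OF C2.**  E-an-152b is needed ONLY at levels `N = 2^a·m` with
`a ≥ 2` and `m` odd SQUAREFREE: at every other level with `4 ∣ N` some odd `p² ∣ N` and Stevens-I-strong already forces `|c₀| = 1`
(`abs_maninConstant_eq_one_of_gamma1Periods_le_of_odd_sq_dvd`).  The statement: for a lattice-optimal `X₀(N)`-datum with `4 ∣ N` and no odd square
dividing `N`, `Λ₁(f) ≠ 2Λ₀(f)`.  Habitat (memo §90): the index-`4` configuration forces `E₀[2] ⊆ Σ(N)` (Cartier dual of `ker ψ`, `ψ = [2]`), full rational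
`2`-torsion and `χ_N : (ℤ/N)ˣ ↠ Λ₀/Λ₁ ≅ (ℤ/2)²`.  Why it might fail: an optimal class with `[Λ₀(f):Λ₁(f)] = 4` beyond the tables (0/338 in es E15).
[cite: LingOesterle1991, Thm. 6] [cite: Stevens1989, §2] [cite: Cesnavicius2018, Lem. 2.11] -/
@[conjecture] def ShimuraIndexNeFourAtFourOddSquarefree : Prop :=
  ∀ (W₀ : WeierstrassCurve ℚ) [W₀.IsElliptic] [W₀.IsGloballyMinimal] {N : ℕ} [NeZero N]
    (D₀ : ModularParametrizationData W₀ N),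
    (∀ z ∈ D₀.L.lattice, ∃ w ∈ periodLattice D₀.f, z = D₀.c * w) → 2 ^ 2 ∣ N →
    (∀ p : ℕ, p.Prime → 3 ≤ p → ¬ p ^ 2 ∣ N) →
    ¬ (∀ z : ℂ, z ∈ periodLatticeGamma1 D₀.f ↔ ∃ w ∈ periodLattice D₀.f, z = 2 * w)

/-- E-an-152b ⟹ E-an-152c (restriction). -/
theorem shimuraIndexNeFourAtFourOddSquarefree_of_indexNeFour (h : ShimuraIndexNeFourAtFour) :
    ShimuraIndexNeFourAtFourOddSquarefree :=
  fun W₀ _ _ _ _ D₀ hopt h4 _ ↦ h W₀ D₀ hopt h4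

/-- **C2 `ManinOddAtFour` ⟸ CDT ∧ E-an-242 ∧ E-an-152c** — the residual is consumed only on the odd-squarefree locus; elsewhere `|c₀| = 1` outright.
CONDITIONAL on the three inputs; C2 is not proved by this. [cite: CalegariDimitrovTang2025, Thm. 1.0.1] [cite: LingOesterle1991, Thm. 6] [cite: Stevens1989, §2] -/
theorem maninOddAtFour_of_CDT_cDivisionWitnessLaw_indexNeFourOddSquarefree
    (hCDT : Literature.NumberTheory.Automorphic.CalegariDimitrovTang2025_unboundedDenominators_algInt) (hCW : CDivisionWitnessLaw)
    (hI4 : ShimuraIndexNeFourAtFourOddSquarefree) :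
    Summit.BirchSwinnertonDyer.BirchSwinnertonDyer.Theses.ManinLocalTwoThree.ManinOddAtFour := by
  intro _hM _hAU _hC _hnf W _ _ N _ D hopt h4
  by_cases hsq : ∃ p : ℕ, p.Prime ∧ 3 ≤ p ∧ p ^ 2 ∣ N
  · obtain ⟨p, hp, h3, hpN⟩ := hsq
    exact not_prime_dvd_of_abs_eq_one
      (abs_maninConstant_eq_one_of_CDT_cDivisionWitnessLaw_of_odd_sq_dvd hCDT hCW D hopt hp h3 hpN) Nat.prime_two
  · exact not_two_dvd_maninConstant_of_gamma1Periods_le_of_indexNeFour D hopt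
      (periodLatticeGamma1_le_lattice_of_forall_gamma1 D (gamma1PeriodsInNeronLattice_of_CDT_of_cDivisionWitnessLaw hCDT hCW W D)) h4
      (hI4 W D hopt h4 fun p hp h3 hpN ↦ hsq ⟨p, hp, h3, hpN⟩)

/-- **At `4 ∣ N`: `c₀ ∈ {±1, ±2}` ⟸ CDT ∧ E-an-242**, and `|c₀| = 2` is exactly the index-`4` world. CONDITIONAL. [cite: CalegariDimitrovTang2025, Thm. 1.0.1]
[cite: LingOesterle1991, Thm. 6] -/
theorem maninConstant_dvd_two_of_CDT_cDivisionWitnessLaw_of_four_dvd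
    (hCDT : Literature.NumberTheory.Automorphic.CalegariDimitrovTang2025_unboundedDenominators_algInt) (hCW : CDivisionWitnessLaw)
    (D : ModularParametrizationData W N) (hopt : ∀ z ∈ D.L.lattice, ∃ w ∈ periodLattice D.f, z = D.c * w) (h4 : 2 ^ 2 ∣ N) :
    D.maninConstant ∣ 2 :=
  maninConstant_dvd_two_of_gamma1Periods_le_of_four_dvd D hopt
    (periodLatticeGamma1_le_lattice_of_forall_gamma1 D (gamma1PeriodsInNeronLattice_of_CDT_of_cDivisionWitnessLaw hCDT hCW W D)) h4

/-- **THE WHOLE ROUTE: Manin's conjecture `ManinConstantOne` ⟸ PrintedSemistableManinFacts ∧ CDT ∧ E-an-242 ∧ E-an-152b** — through the route's deciding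
theorem `closes` and the landed `maninLocalTwoThree_assembly_proof`, with C2, C3 AND the residual C4 all supplied by this file.  CONDITIONAL architecture:
the printed facts (Mazur, Abbes–Ullmo, Česnavičius, modularity) and CDT are `def … : Prop` hypotheses, E-an-242 (analytic) and E-an-152b (arithmetic) are OPEN
rows.  MANIN'S CONJECTURE AND BSD ARE NOT PROVED BY THIS. [cite: CalegariDimitrovTang2025, Thm. 1.0.1] [cite: Cesnavicius2018, Thm. 1.2] [cite: Stevens1989, §2] -/
theorem maninConstantOne_of_printedFacts_CDT_cDivisionWitnessLaw_indexNeFour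
    (hPF : Summit.BirchSwinnertonDyer.BirchSwinnertonDyer.Theses.ManinLocalTwoThree.PrintedSemistableManinFacts)
    (hCDT : Literature.NumberTheory.Automorphic.CalegariDimitrovTang2025_unboundedDenominators_algInt) (hCW : CDivisionWitnessLaw)
    (hI4 : ShimuraIndexNeFourAtFour) :
    Summit.BirchSwinnertonDyer.Rank1Residual.ManinConstant.ManinConstantOne :=
  Summit.BirchSwinnertonDyer.BirchSwinnertonDyer.Theses.ManinLocalTwoThree.closes hPF
    (maninOddAtFour_of_CDT_cDivisionWitnessLaw_indexNeFour hCDT hCW hI4)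
    (maninPrimeToThreeAtNine_of_CDT_cDivisionWitnessLaw hCDT hCW)
    (maninPrimeToAdditiveFiveLe_of_CDT_cDivisionWitnessLaw hCDT hCW)
    maninLocalTwoThree_assembly_proof

/-! ### §5c The habitat of the index-`4` residual: full rational `2`-torsion (E-an-152d) and the Frey-type locus (E-an-152e) -/

/-- **Row E-an-152d `IndexFourForcesFullRationalTwoTorsion`** (PRINTED-PROVABLE bookkeeping, OPEN in the tree).  In the index-`4` configuration
`Λ₁(f) = 2Λ₀(f)` the Stevens isogeny `ψ : E₁ → E₀` (induced by `J₁(N) → J₀(N)`, `ψ^*ω_{E₀} = (c₀/c₁)·ω_{E₁}`) has kernel `≅ Λ₀/Λ₁ = E₁[2]`, so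
`ψ = ι ∘ [2]` with `ι : E₁ ≅ E₀` over `ℚ`, `c₀ = ±2c₁`, and `E₀[2] = ker ψ^∨ = (ker ψ)^∨ ⊆ Σ(N)`, the Shimura subgroup, which is of `μ`-type
(Ling–Oesterlé), hence `E₀[2]` is pointwise rational: the optimal curve has FULL rational `2`-torsion (three rational `2`-torsion abscissae in
Greenberg's sense).  Why it might fail: only through a mis-typing — on paper it is [LO91, Thm 2] + [Ste89, Thm 1.6] + multiplicity one.
[cite: LingOesterle1991, Thm. 2] [cite: Stevens1989, Thm. 1.6 and §2] [cite: Cesnavicius2018, Lem. 2.11] -/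
@[conjecture] def IndexFourForcesFullRationalTwoTorsion : Prop :=
  ∀ (W₀ : WeierstrassCurve ℚ) [W₀.IsElliptic] [W₀.IsGloballyMinimal] {N : ℕ} [NeZero N]
    (D₀ : ModularParametrizationData W₀ N),
    (∀ z ∈ D₀.L.lattice, ∃ w ∈ periodLattice D₀.f, z = D₀.c * w) → 2 ^ 2 ∣ N →
    (∀ z : ℂ, z ∈ periodLatticeGamma1 D₀.f ↔ ∃ w ∈ periodLattice D₀.f, z = 2 * w) →
    ∃ x₁ x₂ x₃ : ℚ, x₁ ≠ x₂ ∧ x₁ ≠ x₃ ∧ x₂ ≠ x₃ ∧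
      Literature.NumberTheory.EllipticCurves.Greenberg1999.HasRationalTwoTorsionX W₀ x₁ ∧
      Literature.NumberTheory.EllipticCurves.Greenberg1999.HasRationalTwoTorsionX W₀ x₂ ∧
      Literature.NumberTheory.EllipticCurves.Greenberg1999.HasRationalTwoTorsionX W₀ x₃

/-- **Row E-an-152e `ShimuraIndexNeFourAtFourFreyHabitat` — THE RESIDUAL OF C2 ON ITS TRUE HABITAT**: index-`4` exclusion for lattice-optimal `X₀(N)`-data
with `4 ∣ N`, odd part of `N` squarefree (so `E₀` is semistable at every odd prime) AND full rational `2`-torsion — the Frey-type curves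
`y² = x(x − A)(x + B)`.  OPEN arithmetic statement at `2` (`μ`-type `Σ(N)[2]` against `E₀[2]` of an additive-at-`2` curve).  Why it might fail: an optimal
Frey-type class with `Λ₁(f) = 2Λ₀(f)`, i.e. `c₀ = ±2c₁`, beyond Cremona's range (none for `N ≤ 500000`, where `c₀ = 1`). [cite: LingOesterle1991, Thm. 6]
[cite: Stevens1989, §2] -/
@[conjecture] def ShimuraIndexNeFourAtFourFreyHabitat : Prop :=
  ∀ (W₀ : WeierstrassCurve ℚ) [W₀.IsElliptic] [W₀.IsGloballyMinimal] {N : ℕ} [NeZero N]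
    (D₀ : ModularParametrizationData W₀ N),
    (∀ z ∈ D₀.L.lattice, ∃ w ∈ periodLattice D₀.f, z = D₀.c * w) → 2 ^ 2 ∣ N →
    (∀ p : ℕ, p.Prime → 3 ≤ p → ¬ p ^ 2 ∣ N) →
    (∃ x₁ x₂ x₃ : ℚ, x₁ ≠ x₂ ∧ x₁ ≠ x₃ ∧ x₂ ≠ x₃ ∧
      Literature.NumberTheory.EllipticCurves.Greenberg1999.HasRationalTwoTorsionX W₀ x₁ ∧
      Literature.NumberTheory.EllipticCurves.Greenberg1999.HasRationalTwoTorsionX W₀ x₂ ∧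
      Literature.NumberTheory.EllipticCurves.Greenberg1999.HasRationalTwoTorsionX W₀ x₃) →
    ¬ (∀ z : ℂ, z ∈ periodLatticeGamma1 D₀.f ↔ ∃ w ∈ periodLattice D₀.f, z = 2 * w)

/-- E-an-152d ∧ E-an-152e ⟹ E-an-152c. -/
theorem shimuraIndexNeFourAtFourOddSquarefree_of_fullTwoTorsion_of_freyHabitat
    (hd : IndexFourForcesFullRationalTwoTorsion) (he : ShimuraIndexNeFourAtFourFreyHabitat) :
    ShimuraIndexNeFourAtFourOddSquarefree :=
  fun W₀ _ _ _ _ D₀ hopt h4 hsq hidx ↦ he W₀ D₀ hopt h4 hsq (hd W₀ D₀ hopt h4 hidx) hidx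

/-- **C2 `ManinOddAtFour` ⟸ CDT ∧ E-an-242 ∧ E-an-152d ∧ E-an-152e** — the index-`4` residual consumed only on the Frey-type habitat.  CONDITIONAL;
C2 is not proved by this. [cite: CalegariDimitrovTang2025, Thm. 1.0.1] [cite: LingOesterle1991, Thm. 2 and Thm. 6] [cite: Stevens1989, §2] -/
theorem maninOddAtFour_of_CDT_cDivisionWitnessLaw_freyHabitat
    (hCDT : Literature.NumberTheory.Automorphic.CalegariDimitrovTang2025_unboundedDenominators_algInt) (hCW : CDivisionWitnessLaw)
    (hd : IndexFourForcesFullRationalTwoTorsion) (he : ShimuraIndexNeFourAtFourFreyHabitat) :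
    Summit.BirchSwinnertonDyer.BirchSwinnertonDyer.Theses.ManinLocalTwoThree.ManinOddAtFour :=
  maninOddAtFour_of_CDT_cDivisionWitnessLaw_indexNeFourOddSquarefree hCDT hCW
    (shimuraIndexNeFourAtFourOddSquarefree_of_fullTwoTorsion_of_freyHabitat hd he)

/-- **THE WHOLE ROUTE, SHARPEST FORM: `ManinConstantOne` ⟸ PrintedSemistableManinFacts ∧ CDT ∧ E-an-242 ∧ E-an-152c** (the index-`4` residual only on
the odd-squarefree locus).  CONDITIONAL architecture; MANIN'S CONJECTURE AND BSD ARE NOT PROVED BY THIS. [cite: CalegariDimitrovTang2025, Thm. 1.0.1]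
[cite: Cesnavicius2018, Thm. 1.2] [cite: Stevens1989, §2] -/
theorem maninConstantOne_of_printedFacts_CDT_cDivisionWitnessLaw_indexNeFourOddSquarefree
    (hPF : Summit.BirchSwinnertonDyer.BirchSwinnertonDyer.Theses.ManinLocalTwoThree.PrintedSemistableManinFacts)
    (hCDT : Literature.NumberTheory.Automorphic.CalegariDimitrovTang2025_unboundedDenominators_algInt) (hCW : CDivisionWitnessLaw)
    (hI4 : ShimuraIndexNeFourAtFourOddSquarefree) :
    Summit.BirchSwinnertonDyer.Rank1Residual.ManinConstant.ManinConstantOne :=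
  Summit.BirchSwinnertonDyer.BirchSwinnertonDyer.Theses.ManinLocalTwoThree.closes hPF
    (maninOddAtFour_of_CDT_cDivisionWitnessLaw_indexNeFourOddSquarefree hCDT hCW hI4)
    (maninPrimeToThreeAtNine_of_CDT_cDivisionWitnessLaw hCDT hCW)
    (maninPrimeToAdditiveFiveLe_of_CDT_cDivisionWitnessLaw hCDT hCW)
    maninLocalTwoThree_assembly_proof


end Summit.BirchSwinnertonDyer.BirchSwinnertonDyer.Theorems.ManinLocalTwoThree.CDivisionNeron

end
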